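import Literature.Geometry.Symplectic.AlmostComplexStructure
import Literature.Geometry.Symplectic.JHolomorphicMap
import Literature.Topology.FourManifolds.ComplexProjectiveSpaceCohomology
import Mathlib.Analysis.Meromorphic.Order
import Mathlib.Geometry.Manifold.Instances.Sphere
import HarnessLib

/-!
# The intersection count of a `J`-sphere with a compact holomorphic curve `{T = 0}` is homological

Named fact (D-0014) requested by the crux chain of `GromovRecognitionRelEnd` (item
stmt-SmoothPoincare4-11009, line `cross-cap-laurent`, core stub `stub_biFoliationCore`; dossier
`Summits/SmoothPoincare4/SmoothPoincare4/Cruxes/GromovRecognitionRelEnd/Lines/cross-cap-laurent-core-c3.md`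
§3b/§4, "(F6)", the bridge between the chain's chart-level INTERSECTION COUNT with a sphere at
infinity — zeros with multiplicity of `T ∘ u` in the two charts, as in the landed
`helper_sphereWedgeCountStable` / `helper_sphereWedgeCountPos` — and homology, needed to read the
clause "the limit stable map represents the same class" of
`Literature.Geometry.Symplectic.gromovCompactness_spheres_dichotomy` (B) as additivity of counts).

## What is printed

* C. Wendl, *Holomorphic Curves in Low Dimensions* (2018), §2.2.2: the homological intersection
  pairing `H₂(M) × H₂(M) → ℤ` of an (almost complex, hence oriented) 4-manifold, and for two closed
  `J`-curves with isolated intersections `[u] · [v] = Σ ι(u, z; v, w)`, the sum of the LOCAL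
  INTERSECTION INDICES (**Thm. 2.49** and the local statement preceding it; McDuff, J. Diff. Geom.
  34 (1991), **Thm. 1.1**: "each such point contributes a positive integer to `C · C'`").
* The local intersection index of a holomorphic map `u : (ℂ, z₀) → X` with a complex hypersurface
  given as the regular zero set `{T = 0}` of a holomorphic function is the ORDER OF VANISHING of
  `T ∘ u` at `z₀` (local degree of a holomorphic function = multiplicity of the zero;
  P. Griffiths, J. Harris, *Principles of Algebraic Geometry*, Ch. 0 §4, "intersection numbers of
  analytic cycles"; R. Bott, L. Tu, *Differential Forms in Algebraic Topology*, §6 and (11.?)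
  Poincaré dual / Thom class: `A ↦ ⟨PD[K], A⟩` is a homomorphism `H₂(X; ℤ) → ℤ`).

## The form vendored here

`X` a compact 4-manifold with almost complex structure `JX`; `T` a smooth `JX`-HOLOMORPHIC function
(`dT ∘ JX = i · dT`) with non-vanishing differential on an open `U`, whose zero set
`K = {y ∈ U | T y = 0}` is COMPACT (a closed `JX`-holomorphic curve). CONCLUSION: there is an
additive functional `c : H₂(X; ℤ) → ℤ` (namely `⟨PD[K], ·⟩` for the complex orientations — only
its existence is recorded) such that for every `JX`-holomorphic two-chart sphere `(u, v)` NOT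
contained in `K`, with glued map `F : ℂℙ¹ → X`, `c (F_* [ℂℙ¹])` equals the chain's intersection
count: the sum over the (finitely many) `z` with `u z ∈ K` of the order of `T ∘ u` at `z`, plus the
order of `T ∘ v` at `0` if `v 0 ∈ K`. Homology classes via the tree's
`Literature.AlgebraicTopology.SingularHomology.singularHomology.map` and
`ComplexProjectiveSpace.homologicalOrientationInt 1`.
-- TODO(general form): arbitrary pairs of closed `J`-curves and the local index `ι(u, z; v, w)`
-- itself are not recorded; nor is the identification of `c` with the intersection form.
Nothing is asserted: users take `(h : jSphere_wedgeCount_factorsThroughHomology)`; SIZE L–XL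
(Poincaré duality / Thom class of `K`, local degree = order of vanishing).

## References

* C. Wendl, *Holomorphic Curves in Low Dimensions*, LNM 2216 (2018), §2.2.2, Thm. 2.49. [Wendl2018]
* D. McDuff, J. Differential Geom. 34 (1991) 143–164, Thm. 1.1. [McDuff1991LocalBehaviour]
* P. Griffiths, J. Harris, *Principles of Algebraic Geometry* (1978), Ch. 0 §4. [GriffithsHarrisPrinciples1978]
* R. Bott, L. W. Tu, *Differential Forms in Algebraic Topology*, GTM 82 (1982), §6. [BottTu1982Forms]
-/

noncomputable section

open scoped Manifold ContDiff Topology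
open Set Function Literature.Topology.FourManifolds Literature.Topology.FourManifolds.ComplexProjectiveSpace
  Literature.AlgebraicTopology.SingularHomology

namespace Literature.Geometry.Symplectic

/-- **The intersection count of `J`-spheres with a compact `J`-holomorphic curve `K = {T = 0}`
factors through `H₂(X; ℤ)`** (Wendl 2018, §2.2.2 / Thm. 2.49: `[u] · [v] = Σ` local indices;
McDuff 1991, Thm. 1.1; local index with a holomorphic hypersurface = order of vanishing,
Griffiths–Harris Ch. 0 §4; `⟨PD[K], ·⟩` is additive, Bott–Tu §6). `X` compact almost complex
4-manifold, `T` smooth `JX`-holomorphic with non-vanishing differential on the open `U`, zero set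
`K` compact: there is an additive `c : H₂(X; ℤ) → ℤ` with `c (F_*[ℂℙ¹]) =` (zero count of `T ∘ u`
with multiplicity) `+` (order of `T ∘ v` at `0` if `v 0 ∈ K`) for every `JX`-two-chart sphere
`(u, v)` not contained in `K`, `F` its glued map.
[cite: Wendl2018, §2.2.2 and Thm. 2.49] [cite: McDuff1991LocalBehaviour, Thm. 1.1] [cite: GriffithsHarrisPrinciples1978, Ch. 0 §4] [cite: BottTu1982Forms, §6] -/
def jSphere_wedgeCount_factorsThroughHomology : Prop :=
  ∀ (X : Type) [TopologicalSpace X] [T2Space X] [SecondCountableTopology X] [CompactSpace X]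
    [ChartedSpace (EuclideanSpace ℝ (Fin 4)) X] [IsManifold (𝓡 4) ∞ X]
    (JX : AlmostComplexStructure (𝓡 4) ∞ X) (T : X → ℂ) (U : Set X),
    IsOpen U → ContMDiffOn (𝓡 4) 𝓘(ℝ, ℂ) ∞ T U →
    (∀ y ∈ U, ∀ w : TangentSpace (𝓡 4) y,
      (show ℂ from mfderiv (𝓡 4) 𝓘(ℝ, ℂ) T y (JX y w)) =
        Complex.I * (show ℂ from mfderiv (𝓡 4) 𝓘(ℝ, ℂ) T y w)) →
    (∀ y ∈ U, mfderiv (𝓡 4) 𝓘(ℝ, ℂ) T y ≠ 0) →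
    IsCompact {y : X | y ∈ U ∧ T y = 0} →
    ∃ c : singularHomology ℤ ℤ X (2 * 1) →+ ℤ,
      ∀ (u v : ℂ → X) (F : C(ComplexProjectiveSpace 1, X)),
        ContMDiff 𝓘(ℝ, ℂ) (𝓡 4) ∞ u → ContMDiff 𝓘(ℝ, ℂ) (𝓡 4) ∞ v → (∀ z : ℂ, z ≠ 0 → v z = u z⁻¹) →
        IsJHolomorphic (𝓡 4) (fun y => JX y) u → IsJHolomorphic (𝓡 4) (fun y => JX y) v →
        (∀ p, CoordNeZero 0 p → F p = u (affineCoordComplex 0 p 0)) →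
        (∀ p, CoordNeZero 1 p → F p = v (affineCoordComplex 1 p 0)) →
        (∃ z : ℂ, ¬ (u z ∈ U ∧ T (u z) = 0)) →
        c (singularHomology.map ℤ ℤ F (2 * 1)
            (ComplexProjectiveSpace.homologicalOrientationInt 1).fundamentalClass) =
          (∑ᶠ z ∈ {z : ℂ | u z ∈ U ∧ T (u z) = 0}, (meromorphicOrderAt (T ∘ u) z).untop₀) +
          (∑ᶠ w ∈ {w : ℂ | w = 0 ∧ v w ∈ U ∧ T (v w) = 0}, (meromorphicOrderAt (T ∘ v) w).untop₀)

end Literature.Geometry.Symplectic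

end
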